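import Mathlib
import Literature.NumberTheory.LFunctions.RobinOscillation

/-!
# Blaschke factors, finite Blaschke products and the test functions `φ = z^N · Π bl` (carve A of `ScrewBlaschkeRigidity`)

Cell `rh-split`, seat `rh-split-screw-bridge` gen 17; card `cards/SPLIT-screw-bridge.md` §22 (census V117′).
ζ-free and RH-free.  §1: the Blaschke factor `bl c z = (z - c)/(1 - c̄ z)`, `|bl| ≤ 1` on the closed disc,
the pointwise estimate `1 - |bl c a| ≤ K_a (1 - |c|)`, and — THE ONLY USE OF THE BLASCHKE CONDITION
`Σ (1 - ‖w i‖) < ∞` — a lower bound for finite Blaschke products at a point `a` of the disc, uniform in the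
finite set (`exists_prod_norm_bl_ge`).  §2: the test functions `phi w F N z = z^N · Π_{i∈F} bl (w i) z`
(vanish at the poles indexed by `F`, bounded by `‖z‖^N` on the closed disc, holomorphic near it).
Carve B (`ScrewBlaschkeRigidity`, imports this file) proves the Cauchy pairing and the rigidity theorem
`cluster_charge_eq_zero`.  Nothing here bears on the truth of RH.
-/

noncomputable section

set_option linter.dupNamespace false

open Complex Metric Set Filter Topology
open scoped Real ComplexConjugate

namespace Summit.RiemannHypothesis.RiemannHypothesis.Theorems.Splittings.ScrewBlaschkeRigidity

/-! ## 1. Blaschke factors -/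

/-- The un-normalised Blaschke factor with zero `c`: `bl c z = (z - c) / (1 - c̄ z)`. -/
def bl (c z : ℂ) : ℂ := (z - c) / (1 - conj c * z)

/-- The Blaschke factor vanishes at its zero: `bl c c = 0`. -/
theorem bl_self (c : ℂ) : bl c c = 0 := by simp [bl]

/-- The denominator `1 - c̄ z` does not vanish when `‖c‖ ‖z‖ < 1`. -/
theorem one_sub_conj_mul_ne_zero {c z : ℂ} (h : ‖c‖ * ‖z‖ < 1) : 1 - conj c * z ≠ 0 := by
  intro h0
  have h1 : conj c * z = 1 := (sub_eq_zero.mp h0).symm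
  have h2 : ‖conj c * z‖ = ‖c‖ * ‖z‖ := by rw [norm_mul, Complex.norm_conj]
  rw [h1, norm_one] at h2
  linarith

/-- The Blaschke identity `|1 - c̄ z|² - |z - c|² = (1 - |z|²)(1 - |c|²)`. -/
theorem norm_sq_sub_norm_sq (c z : ℂ) :
    ‖1 - conj c * z‖ ^ 2 - ‖z - c‖ ^ 2 = (1 - ‖z‖ ^ 2) * (1 - ‖c‖ ^ 2) := by
  simp only [Complex.sq_norm, Complex.normSq_apply, Complex.sub_re, Complex.sub_im, Complex.one_re,
    Complex.one_im, Complex.mul_re, Complex.mul_im, Complex.conj_re, Complex.conj_im]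
  ring

/-- `|bl c z| ≤ 1` for `|c| < 1`, `|z| ≤ 1`. -/
theorem norm_bl_le_one {c z : ℂ} (hc : ‖c‖ < 1) (hz : ‖z‖ ≤ 1) : ‖bl c z‖ ≤ 1 := by
  have hD : 1 - conj c * z ≠ 0 :=
    one_sub_conj_mul_ne_zero (by nlinarith [norm_nonneg c, norm_nonneg z])
  rw [bl, norm_div, div_le_one (norm_pos_iff.2 hD)]
  have h := norm_sq_sub_norm_sq c z
  have h1 : 0 ≤ (1 - ‖z‖ ^ 2) * (1 - ‖c‖ ^ 2) :=
    mul_nonneg (by nlinarith [norm_nonneg z]) (by nlinarith [norm_nonneg c])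
  have h2 : ‖z - c‖ ^ 2 ≤ ‖1 - conj c * z‖ ^ 2 := by linarith
  exact (sq_le_sq₀ (norm_nonneg _) (norm_nonneg _)).1 h2

/-- `bl c a ≠ 0` (so `0 < |bl c a|`) for `a ≠ c` in the open disc. -/
theorem norm_bl_pos {c a : ℂ} (hc : ‖c‖ < 1) (ha : ‖a‖ < 1) (hca : c ≠ a) : 0 < ‖bl c a‖ := by
  rw [norm_pos_iff, bl]
  exact div_ne_zero (sub_ne_zero.2 hca.symm)
    (one_sub_conj_mul_ne_zero (by nlinarith [norm_nonneg c, norm_nonneg a]))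

/-- Blaschke estimate at a fixed point `a` of the disc: `1 - |bl c a| ≤ K_a · (1 - |c|)` with
`K_a = 2 (1 + |a|) / (1 - |a|)`. -/
theorem one_sub_norm_bl_le {c a : ℂ} (hc : ‖c‖ < 1) (ha : ‖a‖ < 1) :
    1 - ‖bl c a‖ ≤ 2 * (1 + ‖a‖) / (1 - ‖a‖) * (1 - ‖c‖) := by
  have h1a : 0 < 1 - ‖a‖ := by linarith
  have hD0 : 1 - conj c * a ≠ 0 :=
    one_sub_conj_mul_ne_zero (by nlinarith [norm_nonneg c, norm_nonneg a])
  have hDpos : 0 < ‖1 - conj c * a‖ := norm_pos_iff.2 hD0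
  have hDge : 1 - ‖a‖ ≤ ‖1 - conj c * a‖ := by
    have hle : ‖conj c * a‖ ≤ ‖a‖ := by
      rw [norm_mul, Complex.norm_conj]
      nlinarith [norm_nonneg a]
    calc 1 - ‖a‖ ≤ ‖(1 : ℂ)‖ - ‖conj c * a‖ := by rw [norm_one]; linarith
      _ ≤ ‖1 - conj c * a‖ := norm_sub_norm_le _ _
  have hle1 : ‖bl c a‖ ≤ 1 := norm_bl_le_one hc ha.le
  have hbl : ‖bl c a‖ = ‖a - c‖ / ‖1 - conj c * a‖ := by rw [bl, norm_div]
  have hND : ‖a - c‖ ≤ ‖1 - conj c * a‖ := by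
    have := hle1
    rwa [hbl, div_le_one hDpos] at this
  have hid := norm_sq_sub_norm_sq c a
  have key : (1 - ‖bl c a‖) * ‖1 - conj c * a‖ ^ 2 ≤ (1 - ‖a‖ ^ 2) * (1 - ‖c‖ ^ 2) := by
    rw [← hid, hbl]
    have hL : (1 - ‖a - c‖ / ‖1 - conj c * a‖) * ‖1 - conj c * a‖ ^ 2
        = ‖1 - conj c * a‖ ^ 2 - ‖a - c‖ * ‖1 - conj c * a‖ := by
      rw [sub_mul, one_mul, div_mul_eq_mul_div, pow_two, mul_div_assoc, mul_self_div_self]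
    rw [hL]
    nlinarith [mul_le_mul_of_nonneg_left hND (norm_nonneg (a - c))]
  have hnum : 0 ≤ (1 - ‖a‖ ^ 2) * (1 - ‖c‖ ^ 2) :=
    mul_nonneg (by nlinarith [norm_nonneg a]) (by nlinarith [norm_nonneg c])
  have step1 : 1 - ‖bl c a‖ ≤ (1 - ‖a‖ ^ 2) * (1 - ‖c‖ ^ 2) / ‖1 - conj c * a‖ ^ 2 := by
    rw [le_div_iff₀ (by positivity)]
    exact key
  have step2 : (1 - ‖a‖ ^ 2) * (1 - ‖c‖ ^ 2) / ‖1 - conj c * a‖ ^ 2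
      ≤ (1 - ‖a‖ ^ 2) * (1 - ‖c‖ ^ 2) / (1 - ‖a‖) ^ 2 :=
    div_le_div_of_nonneg_left hnum (by positivity) (pow_le_pow_left₀ h1a.le hDge 2)
  have step3 : (1 - ‖a‖ ^ 2) * (1 - ‖c‖ ^ 2) / (1 - ‖a‖) ^ 2
      ≤ 2 * (1 + ‖a‖) / (1 - ‖a‖) * (1 - ‖c‖) := by
    rw [div_le_iff₀ (by positivity)]
    have hre : 2 * (1 + ‖a‖) / (1 - ‖a‖) * (1 - ‖c‖) * (1 - ‖a‖) ^ 2
        = 2 * (1 + ‖a‖) * (1 - ‖c‖) * (1 - ‖a‖) := by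
      field_simp
    rw [hre]
    have hc0 := norm_nonneg c
    have hfac : (1 - ‖a‖ ^ 2) * (1 - ‖c‖ ^ 2)
        = (1 + ‖a‖) * (1 - ‖c‖) * (1 - ‖a‖) * (1 + ‖c‖) := by ring
    rw [hfac]
    have hP : 0 ≤ (1 + ‖a‖) * (1 - ‖c‖) * (1 - ‖a‖) :=
      mul_nonneg (mul_nonneg (by positivity) (by linarith)) h1a.le
    nlinarith
  linarith

-- `one_sub_sum_le_prod` (Weierstrass: `1 - Σ u i ≤ Π (1 - u i)` on `[0,1]`) is the tree's
-- `Literature.NumberTheory.LFunctions.RobinOscillation.one_sub_sum_le_prod` (gate dedup.landed) — reused below.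

/-- THE ONLY USE OF THE BLASCHKE CONDITION: finite Blaschke products over poles `≠ a` are bounded
below at `a`, uniformly in the finite set. -/
theorem exists_prod_norm_bl_ge {ι : Type*} {w : ι → ℂ} (hw : ∀ i, ‖w i‖ < 1)
    (hbl : Summable fun i ↦ 1 - ‖w i‖) {a : ℂ} (ha : ‖a‖ < 1) :
    ∃ c : ℝ, 0 < c ∧ ∀ F : Finset ι, (∀ i ∈ F, w i ≠ a) → c ≤ ∏ i ∈ F, ‖bl (w i) a‖ := by
  classical
  have h1a : 0 < 1 - ‖a‖ := by linarith
  set K : ℝ := 2 * (1 + ‖a‖) / (1 - ‖a‖) with hK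
  have hKpos : 0 < K := by positivity
  obtain ⟨S, hS0⟩ : ∃ S : Finset ι, ∑' i : {x // x ∉ S}, (1 - ‖w i‖) < 1 / (2 * K) :=
    ((tendsto_tsum_compl_atTop_zero (fun i ↦ 1 - ‖w i‖)).eventually
      (gt_mem_nhds (by positivity))).exists
  have hS : ∑' i : ({x | x ∉ S} : Set ι), (1 - ‖w (i : ι)‖) < 1 / (2 * K) := hS0
  set S' : Finset ι := S.filter (fun i ↦ w i ≠ a) with hS'
  have hS'pos : 0 < ∏ i ∈ S', ‖bl (w i) a‖ :=
    Finset.prod_pos fun i hi ↦ norm_bl_pos (hw i) ha (Finset.mem_filter.1 hi).2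
  refine ⟨(1 / 2) * ∏ i ∈ S', ‖bl (w i) a‖, by positivity, fun F hF ↦ ?_⟩
  -- split `F` into the part inside `S` and the part outside `S`
  set F₁ : Finset ι := F.filter (fun i ↦ i ∈ S) with hF₁
  set F₂ : Finset ι := F.filter (fun i ↦ i ∉ S) with hF₂
  have hsplit : ∏ i ∈ F, ‖bl (w i) a‖ = (∏ i ∈ F₁, ‖bl (w i) a‖) * ∏ i ∈ F₂, ‖bl (w i) a‖ :=
    (Finset.prod_filter_mul_prod_filter_not F (fun i ↦ i ∈ S) (fun i ↦ ‖bl (w i) a‖)).symm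
  -- (i) the part inside `S` dominates the full product over `S'`
  have hsub : F₁ ⊆ S' := by
    intro i hi
    rw [hF₁, Finset.mem_filter] at hi
    exact Finset.mem_filter.2 ⟨hi.2, hF i hi.1⟩
  have h1 : ∏ i ∈ S', ‖bl (w i) a‖ ≤ ∏ i ∈ F₁, ‖bl (w i) a‖ := by
    rw [← Finset.prod_sdiff hsub]
    have hle : ∏ i ∈ S' \ F₁, ‖bl (w i) a‖ ≤ 1 :=
      Finset.prod_le_one (fun i _ ↦ norm_nonneg _) (fun i _ ↦ norm_bl_le_one (hw i) ha.le)
    have hnn : 0 ≤ ∏ i ∈ F₁, ‖bl (w i) a‖ := Finset.prod_nonneg fun i _ ↦ norm_nonneg _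
    nlinarith
  -- (ii) the part outside `S` is at least `1/2`
  have h2 : 1 / 2 ≤ ∏ i ∈ F₂, ‖bl (w i) a‖ := by
    have hprod : 1 - ∑ i ∈ F₂, (1 - ‖bl (w i) a‖) ≤ ∏ i ∈ F₂, ‖bl (w i) a‖ := by
      have := Literature.NumberTheory.LFunctions.RobinOscillation.one_sub_sum_le_prod F₂
        (fun i ↦ 1 - ‖bl (w i) a‖)
        (fun i _ ↦ sub_nonneg.2 (norm_bl_le_one (hw i) ha.le)) (fun i _ ↦ by
          linarith [norm_nonneg (bl (w i) a)])
      simpa using this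
    have hsum : ∑ i ∈ F₂, (1 - ‖bl (w i) a‖) ≤ K * ∑ i ∈ F₂, (1 - ‖w i‖) := by
      rw [Finset.mul_sum]
      exact Finset.sum_le_sum fun i _ ↦ one_sub_norm_bl_le (hw i) ha
    have htail : ∑ i ∈ F₂, (1 - ‖w i‖) ≤ ∑' i : ({x | x ∉ S} : Set ι), (1 - ‖w (i : ι)‖) := by
      have hind : ∑ i ∈ F₂, (1 - ‖w i‖)
          = ∑ i ∈ F₂, ({x | x ∉ S} : Set ι).indicator (fun i ↦ 1 - ‖w i‖) i := by
        refine Finset.sum_congr rfl fun i hi ↦ ?_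
        have hi' : i ∉ S := (Finset.mem_filter.1 hi).2
        rw [Set.indicator_of_mem (by exact hi')]
      have hnn : ∀ i, 0 ≤ ({x | x ∉ S} : Set ι).indicator (fun i ↦ 1 - ‖w i‖) i := fun i ↦
        Set.indicator_nonneg (fun j _ ↦ sub_nonneg.2 (hw j).le) i
      calc ∑ i ∈ F₂, (1 - ‖w i‖)
          = ∑ i ∈ F₂, ({x | x ∉ S} : Set ι).indicator (fun i ↦ 1 - ‖w i‖) i := hind
        _ ≤ ∑' i, ({x | x ∉ S} : Set ι).indicator (fun i ↦ 1 - ‖w i‖) i :=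
            (hbl.indicator _).sum_le_tsum F₂ fun i _ ↦ hnn i
        _ = ∑' i : ({x | x ∉ S} : Set ι), (1 - ‖w (i : ι)‖) := (tsum_subtype _ _).symm
    have hK2 : K * ∑' i : ({x | x ∉ S} : Set ι), (1 - ‖w (i : ι)‖) ≤ 1 / 2 := by
      have := mul_le_mul_of_nonneg_left hS.le hKpos.le
      calc K * ∑' i : ({x | x ∉ S} : Set ι), (1 - ‖w (i : ι)‖) ≤ K * (1 / (2 * K)) := this
        _ = 1 / 2 := by field_simp
    nlinarith [mul_le_mul_of_nonneg_left htail hKpos.le]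
  -- combine
  rw [hsplit]
  have hnn1 : 0 ≤ ∏ i ∈ F₁, ‖bl (w i) a‖ := Finset.prod_nonneg fun i _ ↦ norm_nonneg _
  calc 1 / 2 * ∏ i ∈ S', ‖bl (w i) a‖ = (∏ i ∈ S', ‖bl (w i) a‖) * (1 / 2) := by ring
    _ ≤ (∏ i ∈ F₁, ‖bl (w i) a‖) * ∏ i ∈ F₂, ‖bl (w i) a‖ :=
      mul_le_mul h1 h2 (by norm_num) hnn1

/-! ## 2. Test functions: a monomial times a finite Blaschke product -/

/-- `phi w F N z = z ^ N · Π_{i ∈ F} bl (w i) z`. -/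
def phi {ι : Type*} (w : ι → ℂ) (F : Finset ι) (N : ℕ) (z : ℂ) : ℂ :=
  z ^ N * ∏ i ∈ F, bl (w i) z

/-- `phi w F N` vanishes at every `w i`, `i ∈ F`. -/
theorem phi_apply_eq_zero {ι : Type*} {w : ι → ℂ} {F : Finset ι} {N : ℕ} {i : ι} (hi : i ∈ F) :
    phi w F N (w i) = 0 := by
  rw [phi, Finset.prod_eq_zero hi (bl_self _), mul_zero]

/-- `|phi w F N z| = |z|^N · Π_{i ∈ F} |bl (w i) z|`. -/
theorem norm_phi {ι : Type*} (w : ι → ℂ) (F : Finset ι) (N : ℕ) (z : ℂ) :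
    ‖phi w F N z‖ = ‖z‖ ^ N * ∏ i ∈ F, ‖bl (w i) z‖ := by
  rw [phi, norm_mul, norm_pow, norm_prod]

/-- `|phi w F N z| ≤ |z|^N` on the closed disc (each Blaschke factor has modulus `≤ 1`). -/
theorem norm_phi_le {ι : Type*} {w : ι → ℂ} (hw : ∀ i, ‖w i‖ < 1) (F : Finset ι) (N : ℕ)
    {z : ℂ} (hz : ‖z‖ ≤ 1) : ‖phi w F N z‖ ≤ ‖z‖ ^ N := by
  rw [norm_phi]
  exact mul_le_of_le_one_right (pow_nonneg (norm_nonneg _) _)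
    (Finset.prod_le_one (fun i _ ↦ norm_nonneg _) (fun i _ ↦ norm_bl_le_one (hw i) hz))

/-- `bl c` is complex-differentiable wherever its denominator `1 - c̄ z` is non-zero. -/
theorem differentiableAt_bl {c z : ℂ} (h : 1 - conj c * z ≠ 0) : DifferentiableAt ℂ (bl c) z := by
  have : bl c = fun z ↦ (z - c) / (1 - conj c * z) := rfl
  rw [this]
  exact ((differentiableAt_id.sub_const c).div
    ((differentiableAt_const _).sub ((differentiableAt_const _).mul differentiableAt_id)) h)

/-- `phi w F N` is complex-differentiable at `z` when `‖w i‖ ‖z‖ < 1` for all `i ∈ F`. -/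
theorem differentiableAt_phi {ι : Type*} {w : ι → ℂ} {F : Finset ι} {N : ℕ} {z : ℂ}
    (hz : ∀ i ∈ F, ‖w i‖ * ‖z‖ < 1) : DifferentiableAt ℂ (phi w F N) z := by
  classical
  have hprod : DifferentiableAt ℂ (fun z ↦ ∏ i ∈ F, bl (w i) z) z := by
    induction F using Finset.induction_on with
    | empty => simp
    | insert j s hj ih =>
      have hfun : (fun z ↦ ∏ i ∈ insert j s, bl (w i) z)
          = fun z ↦ bl (w j) z * ∏ i ∈ s, bl (w i) z := by
        funext z; rw [Finset.prod_insert hj]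
      rw [hfun]
      exact (differentiableAt_bl (one_sub_conj_mul_ne_zero
        (hz j (Finset.mem_insert_self j s)))).mul (ih fun i hi ↦ hz i (Finset.mem_insert_of_mem hi))
  have : phi w F N = fun z ↦ z ^ N * ∏ i ∈ F, bl (w i) z := rfl
  rw [this]
  exact (differentiableAt_pow N).mul hprod

end Summit.RiemannHypothesis.RiemannHypothesis.Theorems.Splittings.ScrewBlaschkeRigidity
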